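import Summits.ResolutionOfSingularities.ResolutionOfSingularities.Theorems.WeightedInvariantIota3Eps
import Summits.ResolutionOfSingularities.ResolutionOfSingularities.Theorems.WeightedInvariantContactCylinderTransport
import Summits.ResolutionOfSingularities.ResolutionOfSingularities.Theorems.WeightedInvariantLexMaxCentreTransport
import HarnessLib

/-!
# The letter `τ` of `ι₃ᵗ`, predicate part: TIE POSITIONS of the P3a move (door `HypersurfaceCentreConstruction`, ORDER (o36))

Topic: `Summits/ResolutionOfSingularities/ResolutionOfSingularities/Theorems`. Definition module for the door item
`HypersurfaceCentreConstruction` (statement `stmt-ResolutionOfSingularities-19897`, route `WeightedInvariant`), line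
`local-engine` of `res-L1-w43-plan-1`, IOTA3-DESIGN v1.3 §8.1 (RULING gen 11 #2, 2026-08-27T12:09:48Z) «τ = THE TIE BIT»,
ORDER (o36) held by res-type-092 (design memo `plan/tools/res-type-092/o36/O36-DESIGN.md` c9cc04d440dbcb6e, (C2)/(L3)).

[OURS · L1 W4.3 · candidate] At a P3a position — `S` regular local of Krull dimension `3`, `f ∈ 𝔪^ν ∖ 𝔪^{ν+1}`, `ε(S,f) = 0`
with the top `(ν ; ε)`-stratum a regular CURVE `V(P₀)`, `P₀ = (x, y)` for a regular system of parameters `(x, y, z)`, and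
`(y, x; r, q; rν)` the lex-maximal transversal Abramovich–Quek–Schober datum of `(S_{P₀}, f)` — the cylinder move of record
(centre `V(P₀)`, weights `(q, r, 0)`) has a successor over `𝔪` of order `ν` (a TIE) iff
`f ∈ 𝒥_{(r+1)ν}((x, y - λx^r, z); (q, r+1, 1))` for some `λ ∈ S` (res-type-092 FINDING #1, 2026-08-27T11:48:54Z, specimen
`y² + x³z⁹ + x⁷`, weights `(2, 3, 0)`, successor `(t⁻¹, z, Y)`; (L3.2) of the memo).  This module TYPES that condition:

* `Iota3.IsTiePresentation S f x y z q r lam` — the data above, `∃ ν` inside (determined by `f`);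
* `Iota3.IsTiePosition R f` — `R` regular local of dimension `3`, `ε = 0`, `dim R ⧸ P₀ = 1`, and SOME tie presentation
  (total on `CommRing`: junk `False` off its hypotheses, so that res-type-013's letter `iotaTau := if IsTiePosition then 1
  else 0` (`…Iota3Tau.lean`, (o40)) is defined everywhere);
* (c6τ) `isTiePosition_of_ringEquiv` / `isTiePosition_ringEquiv_iff` and (c12aτ) `isTiePosition_unit_mul_iff`, with the
  presentation-level transports `IsTiePresentation.map_ringEquiv`, `IsTiePresentation.unit_mul`.

«∃ presentation ⟺ ∀ presentations ⟺ some successor over `𝔪` ties» ((L3.1)/(L3.2)) and the tie-free order drop are the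
kernel sequels `…P3aSpecialFibre`, `…P3aTieFreeDrop` (ORDER (o36)); nothing here is a statement of the manuscript under
review [claim: Hironaka2017, status: under-review].  AI-drafted, weaker than expert review.

## References

* D. Abramovich, M. H. Quek, B. Schober, *Torus actions, weighted blow-ups, and desingularization of plane curves*,
  arXiv:2507.01232 (v3, 2026), Thm 1.3, Thm 3.5. [AbramovichQuekSchober2025]
* J. Włodarczyk, *Functorial resolution by torus actions*, arXiv:2203.03090, §2.3.9, §3.3. [Wlodarczyk2022]
-/

noncomputable section

open IsLocalRing Literature.AlgebraicGeometry.Resolution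
open Summit.ResolutionOfSingularities.ResolutionOfSingularities.Theorems
open Summit.ResolutionOfSingularities.ResolutionOfSingularities.Theorems.ContactCylinder

set_option linter.dupNamespace false -- mandated namespace `Summit.<Summit>.<Problem>` of this single-conjunct summit

namespace Summit.ResolutionOfSingularities.ResolutionOfSingularities.Cruxes.HypersurfaceCentreConstruction.LocalEngine

namespace Iota3

/-! ## The predicates -/

/-- [OURS · L1 W4.3 · IOTA3-DESIGN v1.3 §8.1] **A tie presentation of `(S, f)`**: `(x, y, z)` generate `𝔪`; the generic prime
of the top `(ν ; ε)`-stratum is `P₀ = (x, y)` (a prime); `f ∈ 𝔪^ν ∖ 𝔪^{ν+1}`; `(y/1, x/1; r, q; rν)` is the lex-maximal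
admissible weighted centre germ of `(f/1) ⊆ S_{P₀}` (Abramovich–Quek–Schober Thm 3.5, tree `IsLexMaxWeightedCentreGerm`);
and the TIE MEMBERSHIP `f ∈ 𝒥_{(r+1)ν}((x, y - lam·x^r, z); (q, r+1, 1))`. -/
def IsTiePresentation (S : Type) [CommRing S] [IsLocalRing S] (f x y z : S) (q r : ℕ) (lam : S) : Prop :=
  Ideal.span {x, y, z} = maximalIdeal S ∧
  topStratumPrime iotaOrdEps S f = Ideal.span {x, y} ∧
  ∃ (ν : ℕ) (hP : (Ideal.span ({x, y} : Set S)).IsPrime),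
    f ∈ maximalIdeal S ^ ν ∧ f ∉ maximalIdeal S ^ (ν + 1) ∧
    @IsLexMaxWeightedCentreGerm (Localization.AtPrime (Ideal.span ({x, y} : Set S))) _
      (@Localization.AtPrime.isLocalRing _ _ (Ideal.span ({x, y} : Set S)) hP)
      (Ideal.span {algebraMap S (Localization.AtPrime (Ideal.span ({x, y} : Set S))) f})
      ![algebraMap S (Localization.AtPrime (Ideal.span ({x, y} : Set S))) y,
        algebraMap S (Localization.AtPrime (Ideal.span ({x, y} : Set S))) x] ![r, q] (r * ν) ∧
    f ∈ weightedMonomialIdeal ![x, y - lam * x ^ r, z] ![q, r + 1, 1] ((r + 1) * ν)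

/-- [OURS · L1 W4.3 · IOTA3-DESIGN v1.3 §8.1] **Tie position** (`τ(R, f) = 1`): `R` is a regular local ring of Krull
dimension `3`, `ε(R, f) = 0`, the top `(ν ; ε)`-stratum is a curve (`dim R ⧸ P₀ = 1`, `P₀ = topStratumPrime iotaOrdEps R f`),
and `(R, f)` admits a tie presentation.  Total on `CommRing` (junk `False` off regular local rings). -/
def IsTiePosition (R : Type) [CommRing R] (f : R) : Prop :=
  ∃ (_ : IsRegularLocalRing R), ringKrullDim R = 3 ∧ iotaEps R f = 0 ∧
    ringKrullDim (R ⧸ topStratumPrime iotaOrdEps R f) = 1 ∧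
    ∃ (x y z : R) (q r : ℕ) (lam : R), IsTiePresentation R f x y z q r lam

/-- A tie position is a regular local ring of dimension three with `ε = 0`. [OURS] -/
theorem IsTiePosition.isRegularLocalRing {R : Type} [CommRing R] {f : R} (h : IsTiePosition R f) :
    IsRegularLocalRing R := h.1

/-- Unfolding of `IsTiePosition` on a regular local ring. [OURS] -/
theorem isTiePosition_iff (R : Type) [CommRing R] [IsRegularLocalRing R] (f : R) :
    IsTiePosition R f ↔ ringKrullDim R = 3 ∧ iotaEps R f = 0 ∧
      ringKrullDim (R ⧸ topStratumPrime iotaOrdEps R f) = 1 ∧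
      ∃ (x y z : R) (q r : ℕ) (lam : R), IsTiePresentation R f x y z q r lam :=
  ⟨fun ⟨_, h⟩ => h, fun h => ⟨inferInstance, h⟩⟩

/-! ## Transport tools -/

section Tools

variable {R T : Type} [CommRing R] [CommRing T]

/-- `e(span {a, b}) = span {e a, e b}`. [folklore] -/
theorem map_span_pair (e : R →+* T) (a b : R) :
    (Ideal.span ({a, b} : Set R)).map e = Ideal.span {e a, e b} := by
  rw [Ideal.map_span, Set.image_pair]

/-- `e(span {a, b, c}) = span {e a, e b, e c}`. [folklore] -/
theorem map_span_triple (e : R →+* T) (a b c : R) :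
    (Ideal.span ({a, b, c} : Set R)).map e = Ideal.span {e a, e b, e c} := by
  rw [Ideal.map_span, Set.image_insert_eq, Set.image_pair]

/-- Along a ring isomorphism, `comap e⁻¹ = map e`. [folklore] -/
theorem comap_symm_eq_map (e : R ≃+* T) (I : Ideal R) : I.comap (e.symm : T →+* R) = I.map (e : R →+* T) :=
  (Ideal.map_comap_of_equiv (e : R ≃+* T) (I := I)).symm ▸ rfl

/-- The monomial ideals are transported by ring homomorphisms (three variables, explicit vector form). [folklore] -/
theorem map_weightedMonomialIdeal_three (φ : R →+* T) (a b c : R) (w : Fin 3 → ℕ) (n : ℕ) :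
    (weightedMonomialIdeal ![a, b, c] w n).map φ = weightedMonomialIdeal ![φ a, φ b, φ c] w n := by
  rw [weightedMonomialIdeal, weightedMonomialIdeal, Ideal.map_span]
  have hv : (fun i => φ (![a, b, c] i)) = ![φ a, φ b, φ c] := by
    funext i; fin_cases i <;> rfl
  congr 1
  ext t
  constructor
  · rintro ⟨s, ⟨α, hα, rfl⟩, rfl⟩
    refine ⟨α, hα, ?_⟩
    rw [map_prod]
    exact Finset.prod_congr rfl fun i _ => by rw [map_pow, ← hv]
  · rintro ⟨α, hα, rfl⟩
    refine ⟨∏ i, ![a, b, c] i ^ α i, ⟨α, hα, rfl⟩, ?_⟩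
    rw [map_prod]
    exact Finset.prod_congr rfl fun i _ => by rw [map_pow, ← hv]

/-- The complement of a prime is mapped by a ring isomorphism onto the complement of its image. [folklore] -/
theorem primeCompl_map_ringEquiv (e : R ≃+* T) (P : Ideal R) [P.IsPrime] (Q : Ideal T) [Q.IsPrime]
    (hPQ : P.map (e : R →+* T) = Q) : P.primeCompl.map e.toMonoidHom = Q.primeCompl := by
  subst hPQ
  ext t
  constructor
  · rintro ⟨s, hs, rfl⟩
    change e s ∉ P.map (e : R →+* T)
    rw [← comap_symm_eq_map]
    change ¬ (e.symm (e s) ∈ P)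
    rw [e.symm_apply_apply]
    exact hs
  · intro ht
    refine ⟨e.symm t, ?_, e.apply_symm_apply t⟩
    change e.symm t ∉ P
    intro h
    apply ht
    have h1 := Ideal.mem_map_of_mem (e : R →+* T) h
    rwa [show (e : R →+* T) (e.symm t) = t from e.apply_symm_apply t] at h1

/-- **The localisation isomorphism `R_P ≃+* T_{e P}` induced by `e : R ≃+* T`.** [folklore] -/
def locRingEquiv (e : R ≃+* T) (P : Ideal R) [P.IsPrime] (Q : Ideal T) [Q.IsPrime] (hPQ : P.map (e : R →+* T) = Q) :
    Localization.AtPrime P ≃+* Localization.AtPrime Q :=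
  IsLocalization.ringEquivOfRingEquiv (M := P.primeCompl) (T := Q.primeCompl) (Localization.AtPrime P)
    (Localization.AtPrime Q) e (primeCompl_map_ringEquiv e P Q hPQ)

/-- `locRingEquiv e` sends `f/1` to `e(f)/1`. [folklore] -/
theorem locRingEquiv_apply (e : R ≃+* T) (P : Ideal R) [P.IsPrime] (Q : Ideal T) [Q.IsPrime]
    (hPQ : P.map (e : R →+* T) = Q) (f : R) :
    locRingEquiv e P Q hPQ (algebraMap R (Localization.AtPrime P) f) = algebraMap T (Localization.AtPrime Q) (e f) :=
  IsLocalization.ringEquivOfRingEquiv_eq _ f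

end Tools

/-! ## (c6τ) Transport along ring isomorphisms -/

section Iso

variable {R T : Type} [CommRing R] [CommRing T]

/-- **A tie presentation is transported by a ring isomorphism**: `(x, y, z; q, r; lam) ↦ (e x, e y, e z; q, r; e lam)`.
[OURS] -/
theorem IsTiePresentation.map_ringEquiv [IsLocalRing R] [IsLocalRing T] (e : R ≃+* T) {f x y z : R} {q r : ℕ}
    {lam : R} (h : IsTiePresentation R f x y z q r lam) :
    IsTiePresentation T (e f) (e x) (e y) (e z) q r (e lam) := by
  obtain ⟨hxyz, hP₀, ν, hP, hν, hν', hlex, htie⟩ := h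
  -- the images generate `𝔪_T`
  have hxyz' : Ideal.span {e x, e y, e z} = maximalIdeal T := by
    have h1 := map_span_triple (e : R →+* T) x y z
    simp only [RingHom.coe_coe] at h1
    rw [← h1, hxyz]
    exact map_maximalIdeal_of_surjective (e : R →+* T) e.surjective
  have hPe : (Ideal.span ({x, y} : Set R)).map (e : R →+* T) = Ideal.span {e x, e y} := by
    have h1 := map_span_pair (e : R →+* T) x y
    simpa only [RingHom.coe_coe] using h1
  haveI hP' : (Ideal.span ({e x, e y} : Set T)).IsPrime := by
    rw [← hPe]; exact Ideal.map_isPrime_of_equiv e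
  refine ⟨hxyz', ?_, ν, hP', ?_, ?_, ?_, ?_⟩
  · -- the generic prime of the top stratum
    rw [topStratumPrime_ringEquiv iotaOrdEps e iotaOrdEps_isoInvariant f, hP₀, comap_symm_eq_map, hPe]
  · have h1 := Ideal.mem_map_of_mem (e : R →+* T) hν
    rwa [Ideal.map_pow, map_maximalIdeal_of_surjective (e : R →+* T) e.surjective] at h1
  · intro h1
    apply hν'
    have h2 : f ∈ (maximalIdeal T ^ (ν + 1)).comap (e : R →+* T) := h1
    rwa [← map_maximalIdeal_of_surjective (e : R →+* T) e.surjective, ← Ideal.map_pow,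
      Ideal.comap_map_of_bijective (e : R →+* T) e.bijective] at h2
  · -- lex-maximality transports along `R_{P₀} ≃ T_{e P₀}`
    have key := LexMaxCentre.map_ringEquiv hlex
      (locRingEquiv e (Ideal.span ({x, y} : Set R)) (Ideal.span ({e x, e y} : Set T)) hPe)
    have hI : (Ideal.span {algebraMap R (Localization.AtPrime (Ideal.span ({x, y} : Set R))) f}).map
        (locRingEquiv e (Ideal.span ({x, y} : Set R)) (Ideal.span ({e x, e y} : Set T)) hPe : _ →+* _) = Ideal.span {algebraMap T (Localization.AtPrime (Ideal.span ({e x, e y} : Set T))) (e f)} := by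
      rw [Ideal.map_span, Set.image_singleton]
      congr 2
      exact locRingEquiv_apply e _ _ hPe f
    have hv : (fun i => locRingEquiv e (Ideal.span ({x, y} : Set R)) (Ideal.span ({e x, e y} : Set T)) hPe
        (![algebraMap R (Localization.AtPrime (Ideal.span ({x, y} : Set R))) y,
        algebraMap R (Localization.AtPrime (Ideal.span ({x, y} : Set R))) x] i)) =
        ![algebraMap T (Localization.AtPrime (Ideal.span ({e x, e y} : Set T))) (e y),
          algebraMap T (Localization.AtPrime (Ideal.span ({e x, e y} : Set T))) (e x)] := by
      funext i
      fin_cases i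
      · exact locRingEquiv_apply e _ _ hPe y
      · exact locRingEquiv_apply e _ _ hPe x
    rw [hI, hv] at key
    exact key
  · -- the tie membership
    have h1 := Ideal.mem_map_of_mem (e : R →+* T) htie
    rw [map_weightedMonomialIdeal_three] at h1
    simpa only [RingHom.coe_coe, map_sub, map_mul, map_pow] using h1

/-- **(c6τ), one direction**: a tie position is carried to a tie position by every ring isomorphism. [OURS] -/
theorem isTiePosition_of_ringEquiv (e : R ≃+* T) (f : R) (h : IsTiePosition R f) : IsTiePosition T (e f) := by
  obtain ⟨hreg, hdim, hε, hdim1, x, y, z, q, r, lam, hpres⟩ := h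
  haveI := hreg
  haveI hregT : IsRegularLocalRing T := IsRegularLocalRing.of_ringEquiv e
  refine ⟨hregT, ?_, ?_, ?_, e x, e y, e z, q, r, e lam, hpres.map_ringEquiv e⟩
  · rw [← ringKrullDim_eq_of_ringEquiv e]; exact hdim
  · rw [iotaEps_isoInvariant R T e f]; exact hε
  · have hP : topStratumPrime iotaOrdEps T (e f) = (topStratumPrime iotaOrdEps R f).map (e : R →+* T) := by
      rw [topStratumPrime_ringEquiv iotaOrdEps e iotaOrdEps_isoInvariant f, comap_symm_eq_map]
    rw [← ringKrullDim_eq_of_ringEquiv (Ideal.quotientEquiv _ _ e hP)]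
    exact hdim1

/-- **(c6τ)**: being a tie position is invariant under ring isomorphisms. [OURS] -/
theorem isTiePosition_ringEquiv_iff (e : R ≃+* T) (f : R) : IsTiePosition T (e f) ↔ IsTiePosition R f := by
  refine ⟨fun h => ?_, isTiePosition_of_ringEquiv e f⟩
  have h' := isTiePosition_of_ringEquiv e.symm (e f) h
  rwa [e.symm_apply_apply] at h'

end Iso

/-! ## (c12aτ) Unit invariance -/

section Unit

variable {R : Type} [CommRing R]

/-- **A tie presentation of `f` is one of `v·f` for every unit `v`** (same data). [OURS] -/
theorem IsTiePresentation.unit_mul [IsLocalRing R] {v : R} (hv : IsUnit v) {f x y z : R} {q r : ℕ} {lam : R}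
    (h : IsTiePresentation R f x y z q r lam) : IsTiePresentation R (v * f) x y z q r lam := by
  obtain ⟨hxyz, hP₀, ν, hP, hν, hν', hlex, htie⟩ := h
  refine ⟨hxyz, ?_, ν, hP, Ideal.mul_mem_left _ v hν, fun h1 => hν' ((Ideal.unit_mul_mem_iff_mem _ hv).mp h1), ?_,
    Ideal.mul_mem_left _ v htie⟩
  · rw [topStratumPrime_unit_mul iotaOrdEps iotaOrdEps_unitInvariant R hv f, hP₀]
  · have hspan : Ideal.span {algebraMap R (Localization.AtPrime (Ideal.span ({x, y} : Set R))) (v * f)} =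
        Ideal.span {algebraMap R (Localization.AtPrime (Ideal.span ({x, y} : Set R))) f} := by
      rw [map_mul]
      exact Ideal.span_singleton_mul_left_unit (hv.map _) _
    rw [hspan]
    exact hlex

/-- The same, read backwards with `v⁻¹`. [OURS] -/
theorem IsTiePresentation.of_unit_mul [IsLocalRing R] {v : R} (hv : IsUnit v) {f x y z : R} {q r : ℕ} {lam : R}
    (h : IsTiePresentation R (v * f) x y z q r lam) : IsTiePresentation R f x y z q r lam := by
  obtain ⟨u, rfl⟩ := hv
  have h' := h.unit_mul (v := ((u⁻¹ : Rˣ) : R)) (Units.isUnit _)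
  rwa [← mul_assoc, Units.inv_mul, one_mul] at h'

/-- **(c12aτ)**: being a tie position is invariant under multiplication by units. [OURS] -/
theorem isTiePosition_unit_mul_iff {v : R} (hv : IsUnit v) (f : R) : IsTiePosition R (v * f) ↔ IsTiePosition R f := by
  unfold IsTiePosition
  rw [iotaEps_unitInvariant R v f hv, topStratumPrime_unit_mul iotaOrdEps iotaOrdEps_unitInvariant R hv f]
  constructor
  · rintro ⟨hreg, hdim, hε, hdim1, x, y, z, q, r, lam, hpres⟩
    haveI := hreg
    exact ⟨hreg, hdim, hε, hdim1, x, y, z, q, r, lam, hpres.of_unit_mul hv⟩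
  · rintro ⟨hreg, hdim, hε, hdim1, x, y, z, q, r, lam, hpres⟩
    haveI := hreg
    exact ⟨hreg, hdim, hε, hdim1, x, y, z, q, r, lam, hpres.unit_mul hv⟩

end Unit

end Iota3

end Summit.ResolutionOfSingularities.ResolutionOfSingularities.Cruxes.HypersurfaceCentreConstruction.LocalEngine

end
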